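import Summits.RiemannHypothesis.RiemannHypothesis.Theorems.HandoffWallSequence
import HarnessLib

/-!
# C-I(a) as ONE closed constant — the W-P(P2) RUNG LEAF `SemilocalClassLawAll` and its open TAIL `SemilocalClassLawTail` (RH-FREE)

RH-FREE (LADDER-RH column WEIL, rung PROOF-OF-DATA, target (P2) C-I(a); cell `rh-explicit`; HUMAN RULINGS D-0059 (rungs become ledger
routes) and D-0061 (a route may close a RUNG LEAF = one closed `Prop` constant); typing lane cc-s2-1, pen cc-s2-3).  HONEST FRAMING: both
constants are statements about the tree's semi-local thresholds `a*(S_q) = weilSemilocalThreshold (Nat.primesBelow q)` of TRUNCATED Weil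
forms — UPPER clauses only; neither implies RH nor is implied by it as far as the tree knows; nothing here bears on the truth of RH.  (The
RH-EQUIVALENT statement in this circle is the LOWER clause `∀ q, (log q)/2 ≤ a*(S_q)` = `riemannHypothesis_iff_forall_log_half_le_weilSemilocalThreshold`,
which is NOT a leaf.)

* `SemilocalClassLawAll` — **C-I(a), the whole law**: for every prime `q` and every prime `q' > q`, `a*(S_q) < (log q')/2`.  It is the
  sentence `SemilocalClassLawFrom 0` of `SemilocalClassLaw.lean` (p402719) with the vacuous `0 ≤ q` dropped (the `iff` is by `rfl`-level
  bookkeeping and lands in `SemilocalClassLawBeyondEighty.lean`); by the class theorem it says `a*(S) = a*(S_{q(S)}) < (log q(S)⁺)/2` for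
  EVERY finite `S`.  STATUS: PROVED for `q < 80` (`semilocalClassLawBelow_eighty`, kernel) and at `q = 83, 89, 107` (wall rows); OPEN beyond.
* `SemilocalClassLawTail` — **the CRUX**: the same for the primes `q ≥ 80`.  `semilocalClassLawAll_iff_head_and_tail` splits the leaf
  into the kernel head and this tail; `…_iff_forall_upperClause` restate both with `q⁺ = nextPrime q`; `SemilocalClassLawAll.eq_and_lt`
  is the ∀-finite-S reading (first-gap locality, theory-1's `weilSemilocalThreshold_eq_of_firstGap`).

This file imports only `HandoffWallSequence` (built), so the leaf is importable tonight independently of the build lane.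
References: H. Yoshida, Adv. Stud. Pure Math. 21 (1992) Prop. 6 p. 320 (`Yoshida1992HermitianForms`); A. Connes, C. Consani, Enseign. Math.
69 (2023) §2.1.2 (`ConnesConsani2023`).  The sentences are the cell's (HOME/STRUCTURE.md §2 C-I(a)), not in print as far as searched.
-/

set_option linter.dupNamespace false  -- the mandated namespace repeats `RiemannHypothesis`

noncomputable section

open Set Literature.NumberTheory.LFunctions
open Summit.RiemannHypothesis.RiemannHypothesis.Theorems
open Summit.RiemannHypothesis.RiemannHypothesis.Theorems.HandoffDecomposition
open Summit.RiemannHypothesis.RiemannHypothesis.Theorems.MotivicDoor.SemilocalThreshold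

namespace Summit.RiemannHypothesis.RiemannHypothesis.Theorems.SemilocalClassLaw

/-- **W-P(P2) RUNG LEAF — C-I(a), the whole semilocal class law (RH-FREE, one closed constant)**: for every prime `q` and every
prime `q' > q`, the form keeping exactly the primes `< q` dies below `(log q')/2`. [this cell, HOME/STRUCTURE.md §2 C-I(a); thresholds as in Yoshida1992HermitianForms Prop. 6 restricted to `S`] -/
def SemilocalClassLawAll : Prop :=
  ∀ q : ℕ, q.Prime → ∀ q' : ℕ, q'.Prime → q < q' → weilSemilocalThreshold (Nat.primesBelow q) < Real.log q' / 2

/-- **The C-I(a) TAIL (RH-FREE; the route's CRUX)**: the same for the primes `q ≥ 80` — everything below `80` is a kernel theorem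
(`semilocalClassLawBelow_eighty`, p402719). [this cell, HOME/STRUCTURE.md §2 C-I(a)] -/
def SemilocalClassLawTail : Prop :=
  ∀ q : ℕ, q.Prime → 80 ≤ q → ∀ q' : ℕ, q'.Prime → q < q' → weilSemilocalThreshold (Nat.primesBelow q) < Real.log q' / 2

/-- `∀ q' prime > q, a*(S_q) < (log q')/2` iff the single clause at `q' = q⁺`. [folklore] -/
theorem forall_prime_gt_lt_iff_upperClause {q : ℕ} :
    (∀ q' : ℕ, q'.Prime → q < q' → weilSemilocalThreshold (Nat.primesBelow q) < Real.log q' / 2) ↔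
      weilSemilocalThreshold (Nat.primesBelow q) < Real.log (nextPrime q) / 2 := by
  refine ⟨fun h ↦ h _ (nextPrime_prime q) (lt_nextPrime q), fun h q' hq' hqq' ↦ lt_of_lt_of_le h ?_⟩
  have h1 : (nextPrime q : ℝ) ≤ q' := by exact_mod_cast nextPrime_le hq' hqq'
  have h0 : (0 : ℝ) < nextPrime q := by exact_mod_cast (nextPrime_prime q).pos
  linarith [Real.log_le_log h0 h1]

/-- The leaf in `UC(q)` currency: `SemilocalClassLawAll ↔ ∀ q prime, a*(S_q) < (log q⁺)/2`. [folklore] -/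
theorem semilocalClassLawAll_iff_forall_upperClause :
    SemilocalClassLawAll ↔ ∀ q : ℕ, q.Prime → weilSemilocalThreshold (Nat.primesBelow q) < Real.log (nextPrime q) / 2 :=
  forall₂_congr fun _ _ ↦ forall_prime_gt_lt_iff_upperClause

/-- The tail in `UC(q)` currency. [folklore] -/
theorem semilocalClassLawTail_iff_forall_upperClause :
    SemilocalClassLawTail ↔
      ∀ q : ℕ, q.Prime → 80 ≤ q → weilSemilocalThreshold (Nat.primesBelow q) < Real.log (nextPrime q) / 2 :=
  forall₃_congr fun _ _ _ ↦ forall_prime_gt_lt_iff_upperClause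

/-- **Leaf = kernel head ∧ tail**: `SemilocalClassLawAll ↔ (the law at every prime `q < 80`) ∧ SemilocalClassLawTail`. [folklore] -/
theorem semilocalClassLawAll_iff_head_and_tail :
    SemilocalClassLawAll ↔
      (∀ q : ℕ, q.Prime → q < 80 → ∀ q' : ℕ, q'.Prime → q < q' → weilSemilocalThreshold (Nat.primesBelow q) < Real.log q' / 2) ∧
        SemilocalClassLawTail :=
  ⟨fun h ↦ ⟨fun q hq _ ↦ h q hq, fun q hq _ ↦ h q hq⟩,
    fun h q hq ↦ (Nat.lt_or_ge q 80).elim (h.1 q hq) (h.2 q hq)⟩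

/-- **The ∀-finite-S reading of the leaf (RH-free)**: under `SemilocalClassLawAll`, every finite `S` of class `q` (`{p < q} ⊆ S ∌ q`,
`q` prime) has `a*(S) = a*(S_q) < (log q⁺)/2` — first-gap locality (theory-1). [cite: ConnesConsani2023, §2.1.2 (only the primes below the window enter the semi-local form)] -/
theorem SemilocalClassLawAll.eq_and_lt (h : SemilocalClassLawAll) {S : Finset ℕ} {q : ℕ} (hq : q.Prime)
    (hS : ∀ p < q, p.Prime → p ∈ S) (hqS : q ∉ S) :
    weilSemilocalThreshold S = weilSemilocalThreshold (Nat.primesBelow q) ∧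
      weilSemilocalThreshold S < Real.log (nextPrime q) / 2 := by
  have hU := (semilocalClassLawAll_iff_forall_upperClause.1 h) q hq
  have hE := weilSemilocalThreshold_eq_of_firstGap hq hS hqS hU
  exact ⟨hE, hE ▸ hU⟩

end Summit.RiemannHypothesis.RiemannHypothesis.Theorems.SemilocalClassLaw

end
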